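import Summits.QuantumFields.YangMills.Theorems.UnitScaleTiltProp8IterTangent
import Summits.QuantumFields.YangMills.Theorems.UnitScaleTiltProp7LinAvgOnto
import Summits.QuantumFields.YangMills.Theorems.UnitScaleTiltProp7LinAvgOntoBound
import HarnessLib

/-!
# Route `UnitScaleTilt`, crux K1 «MinimiserStabilityRegPr» (stmt-QuantumFields-19200), stubs `stub_prop8` (V2) ∕ `stub_prop7From14` (V3) — sub-lemma D1c k-fold, FLAT:
# **THE k-FOLD (0.4)-DESCENT IS LINEAR TO SECOND ORDER AT THE FLAT BACKGROUND, WITH LINEARISATION THE k-FOLD COMPOSITE OF `linAvg`**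
# (`norm_iter_sub_one_sub_iterLin_le`)

Cell `ym3-torus` ∕ fleet seat `ym-ust-19200-p2` g4.  p2 g2's `BlockAveragingEMLLinearised.norm_avgFun_sub_one_sub_linAvg_le` (p482040) is [Balaban1985Averaging]
Prop. 3 (122)–(123) at the flat background for ONE step of the (0.4) averaging of record: `‖Ū(c) − 1 − (Q₁Y)(c)‖ ≤ 81(ℓδ)²`, `Y = U − 1`, `ℓ = (d+2)L`.
Here the k-fold statement (print's Prop. 4 shape, [Balaban1985Variational] (156) «Q_j(ηA) = B … or simply Q(ηA) = B» for the family's averaging): for every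
family of operators `Q^{(i)}` with `Q^{(0)} = id`, `Q^{(i+1)} = Q₁ ∘ Q^{(i)}` (the i-fold composite of `linAvg` across the levels — characterised, not defined)
and every `SU(N)` field with `‖U_b − 1‖ ≤ δ`, `81ℓ(4ℓ)^kδ ≤ 1`, `2ℓ(4ℓ)^kδ < δ_N`:  `‖Ū^{(k)}(c) − 1‖ ≤ (4ℓ)^kδ` and
`‖Ū^{(k)}(c) − 1 − (Q^{(k)}Y)(c)‖ ≤ k·81ℓ²(4ℓ)^{2k}δ²` — the derivative of the k-fold descent at the flat configuration IS `Q^{(k)}`, with an explicit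
(lattice-dependent, NOT k-uniform) second-order remainder.  Tools: `norm_linAvg_le` (‖Q₁Y‖ ≤ 3ℓ·max‖Y‖), `linAvg_sub`.  Sorry-free, no definition.
[folklore] ∕ cited.  References: T. Bałaban, CMP 98 (1985) 17–51 [Balaban1985Averaging] (Prop. 3 (122)–(125) p.36, Prop. 4 p.37); CMP 102 (1985) 277–309
[Balaban1985Variational] ((156) p.302); CMP 109 (1987) 249–301 [Balaban1987RG1] ((0.4), (0.11) p.253).
-/

noncomputable section

open scoped BigOperators Matrix.Norms.L2Operator Matrix
open Function

namespace Summit.QuantumFields.YangMills.Theorems.Prop7AvgLinearisation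

open Literature.MathematicalPhysics.QuantumFieldTheory.Balaban1983to89
open T4Continuum AveragingRT BlockAveraging BlockAveragingHaarAC BlockAveragingEMLHaarAC ExpMeanLog BlockAveragingEMLLinearised
open Summit.QuantumFields.YangMills.Theorems.Prop7LinAvgOnto (linAvg_add norm_walkSum_le)

variable {P : Params} {j : ℕ} {n : Type*} [Fintype n] [DecidableEq n] [Nonempty n]

/-! ## §1 The one-step linearised average: subtraction and sup bound -/

omit [Fintype n] [DecidableEq n] [Nonempty n] in
/-- The linearised one-step average of a difference. [cite: Balaban1985Averaging, (124)-(125) p.36] -/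
theorem linAvg_sub (Y Y' : PBond P j → Matrix n n ℂ) (c : PBond P (j + 1)) :
    linAvg (fun b => Y b - Y' b) c = linAvg Y c - linAvg Y' c := by
  have h := linAvg_add (fun b => Y b - Y' b) Y' c
  have hfun : (fun b => (Y b - Y' b) + Y' b) = Y := funext fun b => sub_add_cancel _ _
  rw [hfun] at h
  rw [h, add_sub_cancel_right]

omit [Nonempty n] in
/-- **SUP BOUND OF THE LINEARISED ONE-STEP AVERAGE**: `‖(Q₁Y)(c)‖ ≤ 3ℓ·M` if `‖Y_b‖ ≤ M` for all bonds (`ℓ = (d+2)L`; two staircases and one straight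
segment, each of at most `ℓ` steps). [cite: Balaban1985Averaging, (124)-(125) p.36] -/
theorem norm_linAvg_le (Y : PBond P j → Matrix n n ℂ) {M : ℝ} (hM : 0 ≤ M) (hY : ∀ b, ‖Y b‖ ≤ M) (c : PBond P (j + 1)) :
    ‖linAvg Y c‖ ≤ 3 * (((P.d + 2) * P.L : ℕ) : ℝ) * M := by
  set ℓ : ℝ := (((P.d + 2) * P.L : ℕ) : ℝ) with hℓ
  have hℓ0 : 0 ≤ ℓ := Nat.cast_nonneg _
  have hc : (0 : ℝ) < Fintype.card (Idx P) := Nat.cast_pos.mpr Fintype.card_pos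
  have hseg : ∀ γ : List (T4Continuum.LStep P j), γ.length ≤ (P.d + 2) * P.L → ‖walkSum Y γ‖ ≤ ℓ * M := by
    intro γ hγ
    refine (norm_walkSum_le Y hY γ).trans ?_
    have : (γ.length : ℝ) ≤ ℓ := by rw [hℓ]; exact_mod_cast hγ
    exact mul_le_mul_of_nonneg_right this hM
  have hterm : ∀ i : Idx P,
      ‖walkSum Y (walk (emb c.src) (stairWord i.2.1 (off i.1))) +
          walkSum Y (walk (walkEnd (emb c.src) (stairWord i.2.1 (off i.1))) (List.replicate P.L (c.dir, true))) -
          walkSum Y (walk (emb c.tgt) (stairWord i.2.2 (off i.1)))‖ ≤ 3 * ℓ * M := by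
    intro i
    have h1 := hseg _ (length_walk_stairWord_le (emb c.src) i.2.1 i.1)
    have h2 := hseg _ (length_walk_replicate_le (walkEnd (emb c.src) (stairWord i.2.1 (off i.1))) c.dir true)
    have h3 := hseg _ (length_walk_stairWord_le (emb c.tgt) i.2.2 i.1)
    calc _ ≤ ‖walkSum Y (walk (emb c.src) (stairWord i.2.1 (off i.1))) +
          walkSum Y (walk (walkEnd (emb c.src) (stairWord i.2.1 (off i.1))) (List.replicate P.L (c.dir, true)))‖ +
          ‖walkSum Y (walk (emb c.tgt) (stairWord i.2.2 (off i.1)))‖ := norm_sub_le _ _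
      _ ≤ (‖walkSum Y (walk (emb c.src) (stairWord i.2.1 (off i.1)))‖ +
          ‖walkSum Y (walk (walkEnd (emb c.src) (stairWord i.2.1 (off i.1))) (List.replicate P.L (c.dir, true)))‖) +
          ‖walkSum Y (walk (emb c.tgt) (stairWord i.2.2 (off i.1)))‖ := by gcongr; exact norm_add_le _ _
      _ ≤ (ℓ * M + ℓ * M) + ℓ * M := add_le_add (add_le_add h1 h2) h3
      _ = 3 * ℓ * M := by ring
  rw [linAvg_def, norm_smul, norm_inv, Complex.norm_natCast]
  calc (Fintype.card (Idx P) : ℝ)⁻¹ * ‖∑ i : Idx P, (walkSum Y (walk (emb c.src) (stairWord i.2.1 (off i.1))) +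
          walkSum Y (walk (walkEnd (emb c.src) (stairWord i.2.1 (off i.1))) (List.replicate P.L (c.dir, true))) -
          walkSum Y (walk (emb c.tgt) (stairWord i.2.2 (off i.1))))‖
      ≤ (Fintype.card (Idx P) : ℝ)⁻¹ * ∑ i : Idx P, (3 * ℓ * M) := by
        gcongr
        exact (norm_sum_le _ _).trans (Finset.sum_le_sum fun i _ => hterm i)
    _ = 3 * ℓ * M := by
        rw [Finset.sum_const, Finset.card_univ, nsmul_eq_mul]
        field_simp

/-! ## §2 The k-fold descent to second order at the flat background -/

/-- No averaging: `Ū^{(0)} = U` (definitional unfolding of `Setup.Averaging.iter`, any `LoopAverage`). [cite: Balaban1987RG1, (0.11) p.253] -/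
theorem iter_zero_apply' (ℰ : LoopAverage (Matrix.specialUnitaryGroup n ℂ)) (U : GaugeField P 0 (Matrix.specialUnitaryGroup n ℂ)) :
    Averaging.iter (fun i => blockAvg (P := P) (j := i) ℰ) 0 U = U := by
  show id U = U
  rfl

/-- One more averaging on top: `Ū^{(k+1)} = avgFun ℰ (Ū^{(k)})` (any `LoopAverage`). [cite: Balaban1987RG1, (0.11) p.253] -/
theorem iter_succ_eq_avgFun' (ℰ : LoopAverage (Matrix.specialUnitaryGroup n ℂ)) (k : ℕ) (U : GaugeField P 0 (Matrix.specialUnitaryGroup n ℂ)) :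
    Averaging.iter (fun i => blockAvg (P := P) (j := i) ℰ) (k + 1) U = avgFun ℰ (Averaging.iter (fun i => blockAvg (P := P) (j := i) ℰ) k U) := by
  show ((blockAvg (P := P) (j := k) ℰ).avg ∘ Averaging.iter (fun i => blockAvg (P := P) (j := i) ℰ) k) U = _
  rfl


/-- **THE k-FOLD (0.4)-DESCENT AT THE FLAT BACKGROUND, TO SECOND ORDER.**  Let `Q^{(i)}` be any family with `Q^{(0)}Y = Y` and `Q^{(i+1)}Y = Q₁(Q^{(i)}Y)`
(`Q₁ = linAvg`).  For every `SU(N)` field on the finest lattice with `‖U_b − 1‖ ≤ δ`, `0 ≤ δ`, and every `k` with `81ℓ(4ℓ)^kδ ≤ 1` and `2ℓ(4ℓ)^kδ < δ_N`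
(`ℓ = (d+2)L`):  `‖Ū^{(k)}(c) − 1‖ ≤ (4ℓ)^kδ` and `‖Ū^{(k)}(c) − 1 − (Q^{(k)}Y)(c)‖ ≤ k·81ℓ²(4ℓ)^{2k}δ²` for every level-`k` bond `c`, `Y_b = U_b − 1`.
[cite: Balaban1985Averaging, Prop. 3 (122)-(123) p.36, Prop. 4 p.37; Balaban1985Variational, (156) p.302] -/
theorem norm_iter_sub_one_sub_iterLin_le
    (Q : (i : ℕ) → (PBond P 0 → Matrix n n ℂ) → PBond P i → Matrix n n ℂ)
    (hQ0 : ∀ Y, Q 0 Y = Y) (hQs : ∀ (i : ℕ) (Y : PBond P 0 → Matrix n n ℂ) (c : PBond P (i + 1)), Q (i + 1) Y c = linAvg (Q i Y) c)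
    (U : GaugeField P 0 (Matrix.specialUnitaryGroup n ℂ)) {δ : ℝ} (hδ : 0 ≤ δ)
    (hU : ∀ b, ‖((U b : Matrix.specialUnitaryGroup n ℂ) : Matrix n n ℂ) - 1‖ ≤ δ) :
    ∀ k : ℕ, 81 * (((P.d + 2) * P.L : ℕ) : ℝ) * ((4 * (((P.d + 2) * P.L : ℕ) : ℝ)) ^ k * δ) ≤ 1 →
      2 * ((((P.d + 2) * P.L : ℕ) : ℝ) * ((4 * (((P.d + 2) * P.L : ℕ) : ℝ)) ^ k * δ)) < deltaSU n →
      (∀ c : PBond P k, ‖((Averaging.iter (fun i => blockAvg (P := P) (j := i) (expMeanLogSU (n := n))) k U c :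
          Matrix.specialUnitaryGroup n ℂ) : Matrix n n ℂ) - 1‖ ≤ (4 * (((P.d + 2) * P.L : ℕ) : ℝ)) ^ k * δ) ∧
      ∀ c : PBond P k, ‖((Averaging.iter (fun i => blockAvg (P := P) (j := i) (expMeanLogSU (n := n))) k U c :
          Matrix.specialUnitaryGroup n ℂ) : Matrix n n ℂ) - 1 -
          Q k (fun b => ((U b : Matrix.specialUnitaryGroup n ℂ) : Matrix n n ℂ) - 1) c‖ ≤
        (k : ℝ) * (81 * (((P.d + 2) * P.L : ℕ) : ℝ) ^ 2 * ((4 * (((P.d + 2) * P.L : ℕ) : ℝ)) ^ (2 * k) * δ ^ 2)) := by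
  set ℓ : ℝ := (((P.d + 2) * P.L : ℕ) : ℝ) with hℓ
  have hℓ1 : 1 ≤ ℓ := by
    rw [hℓ]
    have h1 : 1 ≤ (P.d + 2) * P.L := Nat.one_le_iff_ne_zero.mpr (Nat.mul_ne_zero (by omega) (by have := P.hL.2; omega))
    exact_mod_cast h1
  have hℓ0 : 0 ≤ ℓ := by linarith
  set Y : PBond P 0 → Matrix n n ℂ := fun b => ((U b : Matrix.specialUnitaryGroup n ℂ) : Matrix n n ℂ) - 1 with hY
  intro k
  induction k with
  | zero =>
    intro _ _
    refine ⟨fun c => ?_, fun c => ?_⟩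
    · have := hU c
      rw [iter_zero_apply', pow_zero, one_mul]
      exact this
    · rw [iter_zero_apply', hQ0, Nat.cast_zero, zero_mul, sub_self, norm_zero]
  | succ k ih =>
    intro h81 hN
    -- letters for the previous level
    set δk : ℝ := (4 * ℓ) ^ k * δ with hδk
    have hδk0 : 0 ≤ δk := by positivity
    have h4ℓ : 1 ≤ 4 * ℓ := by linarith
    have hmono : δk ≤ (4 * ℓ) ^ (k + 1) * δ := by
      rw [hδk, pow_succ]
      have : (4 * ℓ) ^ k * δ * 1 ≤ (4 * ℓ) ^ k * δ * (4 * ℓ) := mul_le_mul_of_nonneg_left h4ℓ (by positivity)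
      linarith
    have h81k : 81 * ℓ * δk ≤ 1 := le_trans (by nlinarith) h81
    have h81k' : 81 * ℓ * ((4 * ℓ) ^ k * δ) ≤ 1 := h81k
    have hNk : 2 * (ℓ * ((4 * ℓ) ^ k * δ)) < deltaSU n := lt_of_le_of_lt (by nlinarith) hN
    obtain ⟨ih1, ih2⟩ := ih h81k' hNk
    set W : GaugeField P k (Matrix.specialUnitaryGroup n ℂ) :=
      Averaging.iter (fun i => blockAvg (P := P) (j := i) (expMeanLogSU (n := n))) k U with hW
    have hW1 : ∀ c, ‖((W c : Matrix.specialUnitaryGroup n ℂ) : Matrix n n ℂ) - 1‖ ≤ δk := ih1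
    -- one step at level `k`
    have h16 : 16 * (ℓ * δk) ≤ 1 := by nlinarith
    have hone := fun c => norm_avgFun_sub_one_sub_linAvg_le (n := n) W hδk0 hW1 h16 hNk c
    -- the linearised one step applied to the previous remainder
    set E : PBond P k → Matrix n n ℂ := fun c => ((W c : Matrix.specialUnitaryGroup n ℂ) : Matrix n n ℂ) - 1 - Q k Y c with hE
    have hEk : ∀ c, ‖E c‖ ≤ (k : ℝ) * (81 * ℓ ^ 2 * ((4 * ℓ) ^ (2 * k) * δ ^ 2)) := ih2
    have hlin : ∀ c : PBond P (k + 1), linAvg (fun b => ((W b : Matrix.specialUnitaryGroup n ℂ) : Matrix n n ℂ) - 1) c - Q (k + 1) Y c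
        = linAvg E c := by
      intro c
      rw [hQs, ← linAvg_sub]
    have hEk0 : 0 ≤ (k : ℝ) * (81 * ℓ ^ 2 * ((4 * ℓ) ^ (2 * k) * δ ^ 2)) := by positivity
    refine ⟨fun c => ?_, fun c => ?_⟩
    · -- first-order size of the next level
      rw [iter_succ_eq_avgFun']
      have h1 := hone c
      have h2 : ‖linAvg (fun b => ((W b : Matrix.specialUnitaryGroup n ℂ) : Matrix n n ℂ) - 1) c‖ ≤ 3 * ℓ * δk := norm_linAvg_le _ hδk0 hW1 c
      have h3 : ‖((avgFun (expMeanLogSU (n := n)) W c : Matrix.specialUnitaryGroup n ℂ) : Matrix n n ℂ) - 1‖ ≤ 3 * ℓ * δk + 81 * (ℓ * δk) ^ 2 := by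
        have := norm_add_le (((avgFun (expMeanLogSU (n := n)) W c : Matrix.specialUnitaryGroup n ℂ) : Matrix n n ℂ) - 1 -
          linAvg (fun b => ((W b : Matrix.specialUnitaryGroup n ℂ) : Matrix n n ℂ) - 1) c)
          (linAvg (fun b => ((W b : Matrix.specialUnitaryGroup n ℂ) : Matrix n n ℂ) - 1) c)
        rw [sub_add_cancel] at this
        linarith
      calc _ ≤ 3 * ℓ * δk + 81 * (ℓ * δk) ^ 2 := h3
        _ ≤ 3 * ℓ * δk + ℓ * δk := by nlinarith [mul_nonneg hℓ0 hδk0]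
        _ = (4 * ℓ) ^ (k + 1) * δ := by rw [hδk, pow_succ]; ring
    · -- second-order remainder of the next level
      rw [iter_succ_eq_avgFun']
      have h1 := hone c
      have hsplit : ((avgFun (expMeanLogSU (n := n)) W c : Matrix.specialUnitaryGroup n ℂ) : Matrix n n ℂ) - 1 - Q (k + 1) Y c
          = (((avgFun (expMeanLogSU (n := n)) W c : Matrix.specialUnitaryGroup n ℂ) : Matrix n n ℂ) - 1 -
              linAvg (fun b => ((W b : Matrix.specialUnitaryGroup n ℂ) : Matrix n n ℂ) - 1) c) + linAvg E c := by
        rw [← hlin c]; abel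
      rw [hsplit]
      have h2 : ‖linAvg E c‖ ≤ 3 * ℓ * ((k : ℝ) * (81 * ℓ ^ 2 * ((4 * ℓ) ^ (2 * k) * δ ^ 2))) := norm_linAvg_le E hEk0 hEk c
      have hpow : (4 * ℓ) ^ (2 * (k + 1)) = (4 * ℓ) ^ (2 * k) * (4 * ℓ) ^ 2 := by
        rw [show 2 * (k + 1) = 2 * k + 2 by ring, pow_add]
      calc _ ≤ 81 * (ℓ * δk) ^ 2 + 3 * ℓ * ((k : ℝ) * (81 * ℓ ^ 2 * ((4 * ℓ) ^ (2 * k) * δ ^ 2))) := (norm_add_le _ _).trans (add_le_add h1 h2)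
        _ = 81 * ℓ ^ 2 * ((4 * ℓ) ^ (2 * k) * δ ^ 2) * (1 + 3 * ℓ * k) := by
            rw [hδk, show (4 * ℓ) ^ (2 * k) = ((4 * ℓ) ^ k) ^ 2 by rw [← pow_mul, Nat.mul_comm k 2]]; ring
        _ ≤ 81 * ℓ ^ 2 * ((4 * ℓ) ^ (2 * k) * δ ^ 2) * (16 * ℓ ^ 2 * (k + 1)) := by
            apply mul_le_mul_of_nonneg_left _ (by positivity)
            have hk0 : (0 : ℝ) ≤ k := Nat.cast_nonneg _
            nlinarith [mul_nonneg hℓ0 hk0]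
        _ = ((k + 1 : ℕ) : ℝ) * (81 * ℓ ^ 2 * ((4 * ℓ) ^ (2 * (k + 1)) * δ ^ 2)) := by
            rw [hpow]; push_cast; ring

end Summit.QuantumFields.YangMills.Theorems.Prop7AvgLinearisation

end
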